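import Literature.Geometry.Symplectic.NearSymplecticTwoCirclesReduction
import Literature.Geometry.Symplectic.HondaModelNearSymplectic
import HarnessLib

/-!
# Definite transverse zeros: Perutz's Definition 1.1 versus the working definition

Topic `Literature/Geometry/Symplectic` (groundwork `--supports`
`Literature.Geometry.Symplectic.relNearSymplecticTaubesTubes_exists`; everything here is PROVED,
no named fact is introduced).

`NearSymplecticForms.lean` formalises Perutz 2006, Def. 1.1 as printed: a `2`-form is
*near-positive* if at each point either `ω ∧ ω > 0` or `ω = 0` and the intrinsic gradient
`∇ω : T_x X → Λ² T*_x X` has rank `3` (`IsNearPositive`).  Perutz adds (loc. cit., the paragraph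
after Def. 1.1): "to say that `(∇ω)(x)` has rank `3` is to say that its image is a maximal
positive-definite subspace for the wedge-square form".  **That remark is not correct as stated**:
rank `3` and `ω ∧ ω ≥ 0` only make the image positive SEMI-definite, and this file exhibits
(`perutzDegenerateForm`) the closed form

  `ω_ex = x₁ β₁ + x₂ β₂ − 2x₃ dx₁ ∧ dx₂ − x₃³ dt ∧ dx₃`  on `ℝ_t × ℝ³`,

which is near-symplectic in the printed sense (`isNearSymplectic_perutzDegenerateForm`:
`ω_ex ∧ ω_ex = 2(x₁² + x₂² + 2x₃⁴) dt dx₁ dx₂ dx₃ > 0` off the `t`-axis, `Z = {x = 0}`, `∇ω_ex` of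
rank `3`) but whose gradient image contains the wedge-null form `dx₁ ∧ dx₂`
(`not_isStrictlyNearPositive_perutzDegenerateForm`), so that NO conformal structure makes `ω_ex`
self-dual (contrary to Perutz 2006, Lemma 2.1 (c) read with Def. 1.1 verbatim) and Perutz's form
`S` along `Z` is `diag(1, 1, 0)` (`zeroNormalForm_perutzDegenerateForm`; no minority vectors,
`not_isMinorityVector_perutzDegenerateForm`).

The working definition of the literature (Auroux–Donaldson–Katzarkov; Taubes; Honda 2004: a
self-dual harmonic form transverse to the zero section of `Λ⁺`; Perutz 2006, Lemma 2.1) is the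
DEFINITE one, formalised here:

* `IsPositiveZero o ω x` — a transverse zero at which every non-zero value `∇_v ω` of the gradient
  satisfies `(∇_v ω) ∧ (∇_v ω) > 0` for the orientation `o` (the image of `∇ω` is a maximal
  positive-definite subspace);
* `IsStrictlyNearPositive o ω`, `IsStrictlyNearSymplectic o ω` — Def. 1.1 with clause (ii)
  strengthened accordingly; they imply `IsNearPositive` / `IsNearSymplectic`, are local
  (`IsPositiveZero.congr_of_eventuallyEq`), and hold for the untwisted model `Θ`
  (`isStrictlyNearSymplectic_hondaMForm`: `Pf(ω_A(v)) = v₁² + v₂² + 4v₃²`).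

All of Perutz 2006 §§2–3 (Prop. 2.2, Lemma 3.1: "take a metric `g` for which `ω` is self-dual")
and Honda 2004, Thm. 5 concern strictly near-symplectic forms; hypothesis (H) of
`relNearSymplecticTaubesTubes_exists_of_twoEvenCircles_of_hondaNormalForm` should accordingly be
read for `IsStrictlyNearSymplectic` (the strict capstone is in a sibling file).

## References

* T. Perutz, *Zero-sets of near-symplectic forms*, J. Symplectic Geom. 4 (2006), Def. 1.1 and the
  remark following it, Lemma 2.1 [Perutz2006].
* K. Honda, *Local properties of self-dual harmonic 2-forms on a 4-manifold*, J. reine angew.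
  Math. 577 (2004), §1 and §4 Thm. 5 [Honda2004LocalSD].
-/

noncomputable section

open scoped Manifold ContDiff Topology
open Set Function Filter Literature.Geometry.Kaehler Literature.Topology.FourManifolds

namespace Literature.Geometry.Symplectic

/-- Local notation for the model space `ℝ⁴ = EuclideanSpace ℝ (Fin 4)`. -/
local notation "E4" => EuclideanSpace ℝ (Fin 4)

universe u

/-! ### Definite transverse zeros and strictly near-positive forms -/

section Strict

variable {M : Type u} [TopologicalSpace M] [ChartedSpace E4 M] [IsManifold (𝓡 4) ∞ M]

/-- **Positive (= definite) transverse zero** of `ω` at `x` for the orientation `o`: `x` is a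
transverse zero (Perutz 2006, Def. 1.1 (ii)) AND every non-zero value `∇_v ω ∈ Λ² T*_x X` of the
intrinsic gradient has `(∇_v ω) ∧ (∇_v ω) > 0` for `o` (its chart Pfaffian is non-zero with the
sign of `o`), i.e. the image of `∇ω(x)` is a maximal positive-definite subspace for the
wedge-square form — the property Perutz 2006 asserts after Def. 1.1 and uses in Lemma 2.1.
[cite: Perutz2006, Def. 1.1 and Lemma 2.1] -/
def IsPositiveZero (o : SmoothOrientation (𝓡 4) M) (α : MForm (𝓡 4) M ℝ 2) (x : M) : Prop :=
  IsTransverseZero α x ∧ ∀ v : E4, zeroGradient α x v ≠ 0 →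
    pfaffian (zeroGradient α x v) ≠ 0 ∧ o x = signOrientationIn 4 (pfaffian (zeroGradient α x v))

/-- **Strictly near-positive forms**: at each point either `ω ∧ ω > 0` or `ω` has a positive
transverse zero (Perutz 2006, Def. 1.1 with the definiteness of Lemma 2.1 built in).
[cite: Perutz2006, Def. 1.1 and Lemma 2.1] -/
def IsStrictlyNearPositive (o : SmoothOrientation (𝓡 4) M) (α : MForm (𝓡 4) M ℝ 2) : Prop :=
  ∀ x : M, IsWedgeSqPos o α x ∨ IsPositiveZero o α x

/-- **Strictly near-symplectic forms**: smooth, closed and strictly near-positive — the working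
definition of Auroux–Donaldson–Katzarkov / Taubes / Honda 2004 (self-dual harmonic, transverse to
the zero section of `Λ⁺`), cf. Perutz 2006, Lemma 2.1. [cite: Perutz2006, Lemma 2.1] -/
def IsStrictlyNearSymplectic (o : SmoothOrientation (𝓡 4) M) (α : MForm (𝓡 4) M ℝ 2) : Prop :=
  IsSmoothForm α ∧ IsClosedForm α ∧ IsStrictlyNearPositive o α

variable {o : SmoothOrientation (𝓡 4) M} {α β : MForm (𝓡 4) M ℝ 2} {x : M}

/-- A positive zero is a transverse zero. [folklore] -/
theorem IsPositiveZero.isTransverseZero (h : IsPositiveZero o α x) : IsTransverseZero α x :=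
  h.1

/-- A positive zero is a zero. [folklore] -/
theorem IsPositiveZero.mem_zeroLocus (h : IsPositiveZero o α x) : x ∈ zeroLocus α :=
  h.1.mem_zeroLocus

/-- At a positive zero the non-zero gradient values have non-zero Pfaffian. [folklore] -/
theorem IsPositiveZero.pfaffian_ne_zero (h : IsPositiveZero o α x) {v : E4}
    (hv : zeroGradient α x v ≠ 0) : pfaffian (zeroGradient α x v) ≠ 0 :=
  (h.2 v hv).1

/-- At a positive zero the non-zero gradient values are `o`-positive. [folklore] -/
theorem IsPositiveZero.eq_signOrientationIn (h : IsPositiveZero o α x) {v : E4}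
    (hv : zeroGradient α x v ≠ 0) : o x = signOrientationIn 4 (pfaffian (zeroGradient α x v)) :=
  (h.2 v hv).2

omit [IsManifold (𝓡 4) ∞ M] in
/-- **Locality of transverse zeros**: forms agreeing near `x` have the same transverse zeros at
`x`. [folklore] -/
theorem IsTransverseZero.congr_of_eventuallyEq (h : IsTransverseZero α x)
    (heq : ∀ᶠ w in 𝓝 x, β w = α w) : IsTransverseZero β x := by
  refine ⟨?_, ?_⟩
  · have h0 : β x = α x := heq.self_of_nhds
    rw [h0]; exact h.1
  · rw [zeroGradient_congr_of_eventuallyEq heq]; exact h.2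

/-- **Locality of positive zeros.** [folklore] -/
theorem IsPositiveZero.congr_of_eventuallyEq (h : IsPositiveZero o α x)
    (heq : ∀ᶠ w in 𝓝 x, β w = α w) : IsPositiveZero o β x := by
  refine ⟨h.1.congr_of_eventuallyEq heq, fun v hv => ?_⟩
  rw [zeroGradient_congr_of_eventuallyEq heq] at hv ⊢
  exact h.2 v hv

/-- Strictly near-positive forms are near-positive in the sense of Def. 1.1 as printed.
[cite: Perutz2006, Def. 1.1] -/
theorem IsStrictlyNearPositive.isNearPositive (h : IsStrictlyNearPositive o α) :
    IsNearPositive o α :=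
  fun x => (h x).imp_right IsPositiveZero.isTransverseZero

/-- Every zero of a strictly near-positive form is a positive zero. [folklore] -/
theorem IsStrictlyNearPositive.isPositiveZero_of_mem (h : IsStrictlyNearPositive o α)
    (hx : x ∈ zeroLocus α) : IsPositiveZero o α x :=
  (h x).resolve_left fun h' => h'.not_mem_zeroLocus hx

namespace IsStrictlyNearSymplectic

/-- A strictly near-symplectic form is smooth. [folklore] -/
theorem isSmoothForm (h : IsStrictlyNearSymplectic o α) : IsSmoothForm α := h.1

/-- A strictly near-symplectic form is closed. [folklore] -/
theorem isClosedForm (h : IsStrictlyNearSymplectic o α) : IsClosedForm α := h.2.1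

/-- A strictly near-symplectic form is strictly near-positive. [folklore] -/
theorem isStrictlyNearPositive (h : IsStrictlyNearSymplectic o α) : IsStrictlyNearPositive o α :=
  h.2.2

/-- **Strictly near-symplectic forms are near-symplectic** (Def. 1.1 as printed).
[cite: Perutz2006, Def. 1.1] -/
theorem isNearSymplectic (h : IsStrictlyNearSymplectic o α) : IsNearSymplectic o α :=
  ⟨h.1, h.2.1, h.2.2.isNearPositive⟩

end IsStrictlyNearSymplectic

end Strict

/-! ### The untwisted model is strictly near-symplectic -/

/-- **Every axis point is a positive zero of `Θ`**: `∇Θ = ω_A(·)` and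
`Pf(ω_A(v)) = v₁² + v₂² + 4v₃² > 0` for `v ∉ ℝ e_θ = ker ∇Θ`. [cite: Perutz2006, §2 eq. (2)] -/
theorem isPositiveZero_hondaMForm {q : E4} (hq : q ∈ hondaAxis) :
    IsPositiveZero (SmoothOrientation.euclidean 4) hondaMForm q := by
  refine ⟨isTransverseZero_hondaMForm hq, fun v hv => ?_⟩
  rw [zeroGradient_hondaMForm] at hv ⊢
  have hv' : v ∉ hondaAxis := fun h => hv ((hondaFormCLM_eq_zero_iff v).2 h)
  have hpos : 0 < pfaffian (hondaFormCLM v) := pfaffian_hondaMForm_pos hv'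
  refine ⟨hpos.ne', ?_⟩
  rw [SmoothOrientation.euclidean_apply]
  unfold signOrientationIn
  rw [if_pos hpos]

/-- **`Θ` is strictly near-positive.** [cite: Perutz2006, §2 eq. (2)] -/
theorem isStrictlyNearPositive_hondaMForm :
    IsStrictlyNearPositive (SmoothOrientation.euclidean 4) hondaMForm := by
  intro q
  by_cases hq : q ∈ hondaAxis
  · exact Or.inr (isPositiveZero_hondaMForm hq)
  · exact Or.inl (isWedgeSqPos_hondaMForm hq)

/-- **The untwisted model `Θ = ω_A` is strictly near-symplectic** (it is self-dual harmonic for the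
flat metric and transverse to zero). [cite: Perutz2006, §2 eq. (2)] -/
theorem isStrictlyNearSymplectic_hondaMForm :
    IsStrictlyNearSymplectic (SmoothOrientation.euclidean 4) hondaMForm :=
  ⟨isSmoothForm_hondaMForm, isClosedForm_hondaMForm, isStrictlyNearPositive_hondaMForm⟩

/-! ### The degenerate example -/

/-- `dx₁ ∧ dx₂` on `ℝ⁴`. [folklore] -/
def dx12Four : E4 [⋀^Fin 2]→L[ℝ] ℝ :=
  altTwoOfBilinFour ((dxFour 1).smulRight (dxFour 2))

/-- `dt ∧ dx₃` on `ℝ⁴` (`t = x₀`). [folklore] -/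
def dtdx3Four : E4 [⋀^Fin 2]→L[ℝ] ℝ :=
  altTwoOfBilinFour ((dxFour 0).smulRight (dxFour 3))

/-- Values of `dx₁ ∧ dx₂`. [folklore] -/
@[simp] theorem dx12Four_apply (U V : E4) : dx12Four ![U, V] = U 1 * V 2 - V 1 * U 2 := by
  simp [dx12Four]

/-- Values of `dt ∧ dx₃`. [folklore] -/
@[simp] theorem dtdx3Four_apply (U V : E4) : dtdx3Four ![U, V] = U 0 * V 3 - V 0 * U 3 := by
  simp [dtdx3Four]

/-- **The linear part `L(x) = x₁β₁ + x₂β₂ − 2x₃ dx₁ ∧ dx₂`** of the degenerate example (its gradient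
along the axis). [folklore] -/
def degenerateGradCLM : E4 →L[ℝ] (E4 [⋀^Fin 2]→L[ℝ] ℝ) :=
  (dxFour 1).smulRight hondaBeta₁ + (dxFour 2).smulRight hondaBeta₂ -
    (2 : ℝ) • (dxFour 3).smulRight dx12Four

/-- Values of the linear part. [folklore] -/
@[simp] theorem degenerateGradCLM_apply (q U V : E4) :
    degenerateGradCLM q ![U, V] =
      q 1 * (U 0 * V 1 - V 0 * U 1 + (U 2 * V 3 - V 2 * U 3)) +
        q 2 * (U 0 * V 2 - V 0 * U 2 + (U 3 * V 1 - V 3 * U 1)) -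
        2 * q 3 * (U 1 * V 2 - V 1 * U 2) := by
  simp [degenerateGradCLM]
  ring

/-- **The degenerate example** `ω_ex(x) = x₁β₁ + x₂β₂ − 2x₃ dx₁ ∧ dx₂ − x₃³ dt ∧ dx₃` on
`ℝ_t × ℝ³`, as a map `ℝ⁴ → Λ²(ℝ⁴)*`: a counterexample to the remark after Perutz 2006, Def. 1.1.
[cite: Perutz2006, Def. 1.1] -/
def perutzDegenerateCAM (q : E4) : E4 [⋀^Fin 2]→L[ℝ] ℝ :=
  degenerateGradCLM q - (q 3 ^ 3) • dtdx3Four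

/-- **The degenerate example `ω_ex` as a `2`-form on the model space `ℝ⁴`.**
[cite: Perutz2006, Def. 1.1] -/
def perutzDegenerateForm : MForm (𝓡 4) E4 ℝ 2 := fun q => perutzDegenerateCAM q

/-- Values of `ω_ex`. [folklore] -/
@[simp] theorem perutzDegenerateCAM_apply (q U V : E4) :
    perutzDegenerateCAM q ![U, V] =
      q 1 * (U 0 * V 1 - V 0 * U 1 + (U 2 * V 3 - V 2 * U 3)) +
        q 2 * (U 0 * V 2 - V 0 * U 2 + (U 3 * V 1 - V 3 * U 1)) -
        2 * q 3 * (U 1 * V 2 - V 1 * U 2) - q 3 ^ 3 * (U 0 * V 3 - V 0 * U 3) := by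
  simp [perutzDegenerateCAM]

/-- Values of `ω_ex` (as a form). [folklore] -/
@[simp] theorem perutzDegenerateForm_apply (q U V : E4) :
    perutzDegenerateForm q ![U, V] =
      q 1 * (U 0 * V 1 - V 0 * U 1 + (U 2 * V 3 - V 2 * U 3)) +
        q 2 * (U 0 * V 2 - V 0 * U 2 + (U 3 * V 1 - V 3 * U 1)) -
        2 * q 3 * (U 1 * V 2 - V 1 * U 2) - q 3 ^ 3 * (U 0 * V 3 - V 0 * U 3) :=
  perutzDegenerateCAM_apply q U V

/-- The derivative of `ω_ex`: `Dω_ex(q) W = L(W) − 3q₃² W₃ dt ∧ dx₃`. [folklore] -/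
def degenerateDeriv (q : E4) : E4 →L[ℝ] (E4 [⋀^Fin 2]→L[ℝ] ℝ) :=
  degenerateGradCLM - ((3 * q 3 ^ 2) • dxFour 3).smulRight dtdx3Four

/-- Values of the derivative. [folklore] -/
@[simp] theorem degenerateDeriv_apply (q W : E4) :
    degenerateDeriv q W = degenerateGradCLM W - (3 * q 3 ^ 2 * W 3) • dtdx3Four := by
  simp [degenerateDeriv]

/-- `ω_ex` is differentiable with derivative `degenerateDeriv`. [folklore] -/
theorem hasFDerivAt_perutzDegenerateCAM (q : E4) :
    HasFDerivAt perutzDegenerateCAM (degenerateDeriv q) q := by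
  have h3 : HasFDerivAt (fun y : E4 => (dxFour 3 y) ^ 3) ((3 * q 3 ^ 2) • dxFour 3) q := by
    simpa using (dxFour 3).hasFDerivAt.pow 3
  exact degenerateGradCLM.hasFDerivAt.sub (h3.smul_const dtdx3Four)

/-- `ω_ex` is `C^∞` (a polynomial map). [folklore] -/
theorem contDiff_perutzDegenerateCAM : ContDiff ℝ ∞ perutzDegenerateCAM := by
  have h3 : ContDiff ℝ ∞ fun y : E4 => (dxFour 3 y) ^ 3 := (dxFour 3).contDiff.pow 3
  exact degenerateGradCLM.contDiff.sub (h3.smul contDiff_const)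

/-- `ω_ex` is a smooth form. [folklore] -/
theorem isSmoothForm_perutzDegenerateForm : IsSmoothForm perutzDegenerateForm := by
  intro x
  rw [inChart_eq_self_model]
  exact contDiff_perutzDegenerateCAM.contDiffAt.contDiffWithinAt

/-- **`dω_ex = 0` pointwise**: the cyclic sum of `Dω_ex(q)(a)(b, c)` vanishes
(`dω_ex = dx₁ ∧ β₁ + dx₂ ∧ β₂ − 2 dx₃ ∧ dx₁ ∧ dx₂ − 3x₃² dx₃ ∧ dt ∧ dx₃ = (1 + 1 − 2) dx₁dx₂dx₃ = 0`).
[folklore] -/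
theorem alternatizeUncurryFin_degenerateDeriv (q : E4) :
    ContinuousAlternatingMap.alternatizeUncurryFin (degenerateDeriv q) = 0 := by
  ext v
  rw [alternatizeUncurryFin_apply_fin_three]
  rw [show (0 : E4 [⋀^Fin 3]→L[ℝ] ℝ) v = 0 from rfl]
  simp only [degenerateDeriv_apply, ContinuousAlternatingMap.sub_apply,
    ContinuousAlternatingMap.smul_apply, degenerateGradCLM_apply, dtdx3Four_apply, smul_eq_mul]
  ring

/-- **`ω_ex` is closed.** [folklore] -/
theorem isClosedForm_perutzDegenerateForm : IsClosedForm perutzDegenerateForm := by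
  change mextDeriv perutzDegenerateForm = 0
  funext x
  have hf : fderiv ℝ perutzDegenerateForm x = degenerateDeriv x :=
    (hasFDerivAt_perutzDegenerateCAM x).fderiv
  rw [mextDeriv_eq_extDeriv, extDeriv, hf, alternatizeUncurryFin_degenerateDeriv]
  rfl

/-- **`Pf(ω_ex(q)) = q₁² + q₂² + 2q₃⁴`**, i.e. `ω_ex ∧ ω_ex = 2(x₁² + x₂² + 2x₃⁴) dt dx₁ dx₂ dx₃`:
positive off the axis although the linear part alone only gives `x₁² + x₂²` (the cubic term
`−x₃³ dt ∧ dx₃` pairs with `−2x₃ dx₁ ∧ dx₂`). [folklore] -/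
theorem pfaffian_perutzDegenerateForm (q : E4) :
    pfaffian (perutzDegenerateForm q) = q 1 ^ 2 + q 2 ^ 2 + 2 * q 3 ^ 4 := by
  change pfaffian (perutzDegenerateCAM q) = _
  simp [pfaffian, stdVec]
  ring

/-- `ω_ex(q) = 0` iff `q` is on the axis. [folklore] -/
theorem perutzDegenerateForm_eq_zero_iff (q : E4) : perutzDegenerateForm q = 0 ↔ q ∈ hondaAxis := by
  rw [mem_hondaAxis]
  change perutzDegenerateCAM q = 0 ↔ _
  constructor
  · intro h
    have h01 := DFunLike.congr_fun h ![EuclideanSpace.single 0 1, EuclideanSpace.single 1 1]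
    have h02 := DFunLike.congr_fun h ![EuclideanSpace.single 0 1, EuclideanSpace.single 2 1]
    have h12 := DFunLike.congr_fun h ![EuclideanSpace.single 1 1, EuclideanSpace.single 2 1]
    simp at h01 h02 h12
    exact ⟨h01, h02, by simpa using h12⟩
  · rintro ⟨h1, h2, h3⟩
    ext v
    have hv : v = ![v 0, v 1] := by funext i; fin_cases i <;> rfl
    rw [hv, perutzDegenerateCAM_apply, h1, h2, h3]
    simp

/-- **`Z_{ω_ex}` is the axis.** [folklore] -/
theorem zeroLocus_perutzDegenerateForm : zeroLocus perutzDegenerateForm = hondaAxis := by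
  ext q
  rw [mem_zeroLocus, perutzDegenerateForm_eq_zero_iff]

/-- Off the axis `ω_ex ∧ ω_ex > 0` for the standard orientation. [folklore] -/
theorem isWedgeSqPos_perutzDegenerateForm {q : E4} (hq : q ∉ hondaAxis) :
    IsWedgeSqPos (SmoothOrientation.euclidean 4) perutzDegenerateForm q := by
  have hpos : 0 < pfaffian (perutzDegenerateForm q) := by
    rw [pfaffian_perutzDegenerateForm]
    rw [mem_hondaAxis, not_and_or, not_and_or] at hq
    rcases hq with h | h | h
    · have := sq_pos_of_ne_zero h; positivity
    · have := sq_pos_of_ne_zero h; positivity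
    · have : 0 < q 3 ^ 4 := by positivity
      positivity
  refine ⟨hpos.ne', ?_⟩
  rw [SmoothOrientation.euclidean_apply]
  unfold signOrientationIn
  rw [if_pos hpos]

/-- **On the axis the gradient of `ω_ex` is the linear part `L`** (the cubic term has vanishing
derivative there). [folklore] -/
theorem zeroGradient_perutzDegenerateForm {q : E4} (hq : q ∈ hondaAxis) :
    zeroGradient perutzDegenerateForm q = degenerateGradCLM := by
  have hf : fderiv ℝ perutzDegenerateForm q = degenerateDeriv q :=
    (hasFDerivAt_perutzDegenerateCAM q).fderiv
  rw [zeroGradient, inChart_eq_self_model, show extChartAt (𝓡 4) q q = q by simp, hf]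
  ext1 W
  rw [degenerateDeriv_apply, (mem_hondaAxis.1 hq).2.2]
  simp

/-- `L(U) = 0` iff `U` is on the axis. [folklore] -/
theorem degenerateGradCLM_eq_zero_iff (U : E4) : degenerateGradCLM U = 0 ↔ U ∈ hondaAxis := by
  rw [mem_hondaAxis]
  constructor
  · intro h
    have h01 := DFunLike.congr_fun h ![EuclideanSpace.single 0 1, EuclideanSpace.single 1 1]
    have h02 := DFunLike.congr_fun h ![EuclideanSpace.single 0 1, EuclideanSpace.single 2 1]
    have h12 := DFunLike.congr_fun h ![EuclideanSpace.single 1 1, EuclideanSpace.single 2 1]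
    simp at h01 h02 h12
    exact ⟨h01, h02, by linarith⟩
  · rintro ⟨h1, h2, h3⟩
    ext v
    have hv : v = ![v 0, v 1] := by funext i; fin_cases i <;> rfl
    rw [hv, degenerateGradCLM_apply, h1, h2, h3]
    simp

/-- The kernel of `L` is the line `ℝ e_θ`. [folklore] -/
theorem ker_degenerateGradCLM :
    LinearMap.ker degenerateGradCLM.toLinearMap = ℝ ∙ (EuclideanSpace.single (0 : Fin 4) (1 : ℝ)) := by
  ext U
  rw [LinearMap.mem_ker, ContinuousLinearMap.coe_coe, degenerateGradCLM_eq_zero_iff, mem_hondaAxis,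
    Submodule.mem_span_singleton]
  constructor
  · rintro ⟨h1, h2, h3⟩
    refine ⟨U 0, ?_⟩
    ext i
    fin_cases i <;> simp [h1, h2, h3]
  · rintro ⟨a, rfl⟩
    simp

/-- `L` has rank `3`. [folklore] -/
theorem finrank_range_degenerateGradCLM :
    Module.finrank ℝ (LinearMap.range degenerateGradCLM.toLinearMap) = 3 := by
  have hrn := LinearMap.finrank_range_add_finrank_ker degenerateGradCLM.toLinearMap
  have hker : Module.finrank ℝ (LinearMap.ker degenerateGradCLM.toLinearMap) = 1 := by
    rw [ker_degenerateGradCLM]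
    exact finrank_span_singleton (by simp)
  rw [hker, finrank_euclideanSpace_fin] at hrn
  omega

/-- **Every axis point is a transverse zero of `ω_ex`** (rank `3`). [folklore] -/
theorem isTransverseZero_perutzDegenerateForm {q : E4} (hq : q ∈ hondaAxis) :
    IsTransverseZero perutzDegenerateForm q := by
  refine ⟨(perutzDegenerateForm_eq_zero_iff q).2 hq, ?_⟩
  rw [zeroGradient_perutzDegenerateForm hq]
  exact finrank_range_degenerateGradCLM

/-- **`ω_ex` is near-symplectic in the sense of Perutz 2006, Def. 1.1 as printed** (standard
orientation of `ℝ⁴`). [cite: Perutz2006, Def. 1.1] -/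
theorem isNearSymplectic_perutzDegenerateForm :
    IsNearSymplectic (SmoothOrientation.euclidean 4) perutzDegenerateForm := by
  refine ⟨isSmoothForm_perutzDegenerateForm, isClosedForm_perutzDegenerateForm, fun q => ?_⟩
  by_cases hq : q ∈ hondaAxis
  · exact Or.inr (isTransverseZero_perutzDegenerateForm hq)
  · exact Or.inl (isWedgeSqPos_perutzDegenerateForm hq)

/-- **The gradient image of `ω_ex` contains the wedge-null form `−2 dx₁ ∧ dx₂ = ∇_{∂₃} ω_ex`**:
`Pf(∇_{∂₃} ω_ex) = 0` although `∇_{∂₃} ω_ex ≠ 0`. [folklore] -/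
theorem pfaffian_zeroGradient_perutzDegenerateForm_e3 {q : E4} (hq : q ∈ hondaAxis) :
    zeroGradient perutzDegenerateForm q (EuclideanSpace.single 3 1) ≠ 0 ∧
      pfaffian (zeroGradient perutzDegenerateForm q (EuclideanSpace.single 3 1)) = 0 := by
  rw [zeroGradient_perutzDegenerateForm hq]
  refine ⟨fun h => ?_, ?_⟩
  · have := DFunLike.congr_fun h ![EuclideanSpace.single 1 1, EuclideanSpace.single 2 1]
    simp at this
  · simp [pfaffian, stdVec]

/-- **No axis point of `ω_ex` is a positive zero, for any orientation.** [folklore] -/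
theorem not_isPositiveZero_perutzDegenerateForm (o : SmoothOrientation (𝓡 4) E4) {q : E4}
    (hq : q ∈ hondaAxis) : ¬ IsPositiveZero o perutzDegenerateForm q := by
  intro h
  obtain ⟨hne, hpf⟩ := pfaffian_zeroGradient_perutzDegenerateForm_e3 hq
  exact (h.2 _ hne).1 hpf

/-- **`ω_ex` is NOT strictly near-positive, for any orientation of `ℝ⁴`** — so Perutz 2006,
Def. 1.1 as printed is strictly weaker than the definite (working) definition, and the remark
following Def. 1.1 fails for `ω_ex` at every point of its zero set. [cite: Perutz2006, Def. 1.1] -/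
theorem not_isStrictlyNearPositive_perutzDegenerateForm (o : SmoothOrientation (𝓡 4) E4) :
    ¬ IsStrictlyNearPositive o perutzDegenerateForm := by
  intro h
  have h0 : (0 : E4) ∈ hondaAxis := by simp [mem_hondaAxis]
  have hz : (0 : E4) ∈ zeroLocus perutzDegenerateForm := by
    rw [zeroLocus_perutzDegenerateForm]; exact h0
  exact not_isPositiveZero_perutzDegenerateForm o h0 (h.isPositiveZero_of_mem hz)

/-- **Perutz's form `S` of `ω_ex` along its zero set is `diag(1, 1, 0)`**:
`S(v, w) = (∇_v ω_ex)(∂_t, w) = v₁w₁ + v₂w₂` (degenerate: no eigenline `L⁻`). [folklore] -/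
theorem zeroNormalForm_perutzDegenerateForm {q : E4} (hq : q ∈ hondaAxis) (v w : E4) :
    zeroNormalForm perutzDegenerateForm q (EuclideanSpace.single 0 1) v w = v 1 * w 1 + v 2 * w 2 := by
  rw [zeroNormalForm_apply, zeroGradient_perutzDegenerateForm hq, degenerateGradCLM_apply]
  simp

/-- **`S = diag(1, 1, 0)` has no minority vectors**: the zero circle of `ω_ex` (on the quotient
`S¹ × ℝ³`) is not even in the sense of `IsEvenZeroCircle`, and Perutz's parity (Prop. 2.2) is
undefined for it. [folklore] -/
theorem not_isMinorityVector_perutzDegenerateForm {q : E4} (hq : q ∈ hondaAxis) (v : E4) :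
    ¬ IsMinorityVector (zeroNormalForm perutzDegenerateForm q (EuclideanSpace.single 0 1)) v := by
  rintro ⟨hne, hle⟩
  -- test against `w = (0, -v₂, v₁, 0)`, which is `S`-orthogonal to `v`
  have h := hle (WithLp.toLp 2 ![0, -v 2, v 1, 0])
  simp only [zeroNormalForm_perutzDegenerateForm hq] at hne h
  simp at h
  have ha : 0 ≤ v 1 * v 1 + v 2 * v 2 := by nlinarith [sq_nonneg (v 1), sq_nonneg (v 2)]
  have hlt : 0 < v 1 * v 1 + v 2 * v 2 := lt_of_le_of_ne ha (Ne.symm hne)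
  nlinarith [hlt, h, sq_nonneg (v 1), sq_nonneg (v 2)]

end Literature.Geometry.Symplectic

end
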